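import Literature.NumberTheory.IwasawaTheory.ClassicalMuVanishesDivisionFieldFiveNonsplit
import Literature.NumberTheory.EllipticCurves.FineSelmerLayerCriterionRat
import Literature.NumberTheory.NumberFields.ClassGroupRankEqualityCyclotomicTowerSaturated
import Literature.RepresentationTheory.FiniteGroups.CosetKernelModuleLift
import HarnessLib

/-!
# The rank-equality road to statement (A) of Coates–Sujatha at `(E, p)`, image-agnostic form:
# `rank_p Cl(ℚ(E[p])^{⟨σ̄_s⟩}) = rank_p Cl(ℚ(E[p])^{⟨σ̄_m, σ̄_s⟩})` with `σ̄_m = −1 ∈ I(𝔮|p)` and `p ∤ #Gal(ℚ(E[p])/ℚ)`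

Topic `NumberTheory/EllipticCurves` (namespace = path, grouping sub-namespace `CoatesSujatha2005.RankEqualityRoad`).  THEOREM-ONLY file (no definition,
no named fact, no `sorry`), written by the prover seat `bsd-potss-k8t-c4` g25 (cell `bsd-potss`; `--supports` stmt-BirchSwinnertonDyer-19982; closes
nothing; neither BSD nor Conjecture A is booked for any curve — the conclusion of §2 IS statement (A) at `(E, p)` under displayed per-curve hypotheses).
Generalises `FineSelmerRankEqualityNonsplitCartanFive` (`C_ns⁺(5)`, same seat) to any odd `p` and any mod-`p` image of order prime to `p`:

DATA. `E/K` (`K` a number field; `K = ℚ` in §2), `p` odd, a basis `e` of `E[p]`, and three elements of `Γ_K`: `σ_s` acting in the basis `e` by a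
matrix `S` with first row `(1, 0)` (so `H = ⟨σ̄_s⟩` fixes the functional «first coordinate»; `L^H ⊆ K(P)`-type leaf, `L = K(E[p])`), `σ_m` acting as
`−1`, and `σ_x` acting by a matrix `X` with `X₀₁ ≠ 0` (so `E[p]` is not the sum of the two coordinate lines as a `Γ`-module along the first
functional); `p ∤ #Gal(L/K)` (`hG`).  HYPOTHESES. `#Cl(L^{⟨σ̄_s⟩})[p] = #Cl(L^{⟨σ̄_m, σ̄_s⟩})[p]` (`hrank`) and `σ̄_m ∈ I(𝔮)` for every prime `𝔮 ∋ p`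
of `L` (`hcI`).  CONCLUSION. §1: for every `ℤ_p`-extension `κ` of `K` with a totally ramified prime and every layer `n`, every `Γ_K`-equivariant
additive `Cl(𝓞_{L·K_n}) → E[p]` is zero; §2 (`K = ℚ`, `κ` cyclotomic): statement (A) at `(E, p)` (door L5 `conjA_of_homTrivial_layer_above_p`).
MECHANISM as in the `C_ns⁺(5)` file: rank-equality transfer (`RankEqualityTransfer.equivariantHom_cosetKernel_layer_eq_zero_of_saturated`) +
Frobenius reciprocity (`invariant_lift_of_forall_equivariantHom_eq_zero`) on the character «first coordinate of `f`».

## References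

* J. Coates, R. Sujatha, *Fine Selmer groups of elliptic curves over p-adic Lie extensions*, Math. Ann. 331 (2005), §3 Thm. 3.4, Lemma 3.8. [CoatesSujatha2005]
* S. V. Deo, A. Ray, R. Sujatha, *On the μ equals zero conjecture for fine Selmer groups in Iwasawa theory*, PAMQ 19 (2023), §3 Thm. 3.8. [DeoRaySujatha2023]
* K. Iwasawa, *A note on class numbers of algebraic number fields*, Abh. Math. Sem. Hamburg 20 (1956), §§3–5. [Iwasawa1956]
* J.-P. Serre, *Linear representations of finite groups*, GTM 42 (1977), §7.2 Thm. 13. [SerreLinearRepresentations1977]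
-/

set_option autoImplicit false

noncomputable section

open scoped Classical NumberField Matrix
open WeierstrassCurve Field IntermediateField
  Literature.NumberTheory.GaloisRepresentations
  Literature.NumberTheory.IwasawaTheory
  Literature.NumberTheory.NumberFields Literature.RepresentationTheory.FiniteGroups

namespace Literature.NumberTheory.EllipticCurves.CoatesSujatha2005

namespace RankEqualityRoad

/-! ### §0 Helpers -/

/-- In `𝔽_p`, `p` odd, `−r = r` forces `r = 0`. [folklore] -/
private theorem zmod_eq_zero_of_neg_eq {p : ℕ} [hp : Fact p.Prime] (hp2 : p ≠ 2) (r : ZMod p) (h : -r = r) : r = 0 := by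
  have h2 : (2 : ZMod p) ≠ 0 := by
    intro h0
    have h1 : ((2 : ℕ) : ZMod p) = 0 := by exact_mod_cast h0
    rw [ZMod.natCast_eq_zero_iff] at h1
    exact hp2 ((Nat.prime_dvd_prime_iff_eq hp.out Nat.prime_two).mp h1)
  have h3 : (2 : ZMod p) * r = 0 := by rw [two_mul]; nth_rewrite 1 [← h]; rw [neg_add_cancel]
  exact (mul_eq_zero.mp h3).resolve_left h2

/-- First coordinate of `M v` for a `2 × 2` matrix. [folklore] -/
private theorem mulVec_zero_eq {p : ℕ} (M : Matrix (Fin 2) (Fin 2) (ZMod p)) (w : Fin 2 → ZMod p) :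
    (M *ᵥ w) 0 = M 0 0 * w 0 + M 0 1 * w 1 := by
  simp [Matrix.mulVec, dotProduct, Fin.sum_univ_two]

/-- First coordinate of `S^k v` when the first row of `S` is `(1, 0)`. [folklore] -/
private theorem pow_mulVec_zero_of_row {p : ℕ} (S : Matrix (Fin 2) (Fin 2) (ZMod p)) (hS0 : S 0 0 = 1) (hS1 : S 0 1 = 0)
    (k : ℕ) (w : Fin 2 → ZMod p) : (S ^ k *ᵥ w) 0 = w 0 := by
  induction k generalizing w with
  | zero => rw [pow_zero, Matrix.one_mulVec]
  | succ k ih => rw [pow_succ, ← Matrix.mulVec_mulVec, ih, mulVec_zero_eq, hS0, hS1, one_mul, zero_mul, add_zero]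

/-- Two matrices acting alike on all `e P` coincide (`e` onto). [folklore] -/
private theorem matrix_eq_of_forall_mulVec₃ {A : Type*} [AddCommGroup A] {n : ℕ} (e : A ≃+ (Fin 2 → ZMod n))
    {M N : Matrix (Fin 2) (Fin 2) (ZMod n)} (h : ∀ P : A, M *ᵥ e P = N *ᵥ e P) : M = N := by
  have h' : ∀ v, M *ᵥ v = N *ᵥ v := fun v => by simpa using h (e.symm v)
  ext i j
  have := congrFun (h' (Pi.single j 1)) i
  simpa [Matrix.mulVec_single] using this

/-- Restriction `Γ_F → Gal(E/F)` is onto. [folklore] -/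
private theorem absRestrictNormalHom_surjective₃ {F : Type} [Field F] (E : IntermediateField F (AlgebraicClosure F))
    [Normal F E] : Function.Surjective (absRestrictNormalHom E) := fun g => by
  obtain ⟨σ, hσ⟩ := AlgEquiv.restrictNormalHom_surjective (AlgebraicClosure F) g
  exact ⟨(Field.absoluteGaloisGroup.toAlgEquiv F).symm σ, hσ⟩

/-- `p ∤ [L : k]` from `p ∤ #Gal(L/k)`. [folklore] -/
private theorem not_dvd_finrank_of_not_dvd_card₃ {k : Type} [Field k] (L : IntermediateField k (AlgebraicClosure k))
    [FiniteDimensional k L] [IsGalois k L] {p : ℕ} (h : ¬ p ∣ Nat.card (L ≃ₐ[k] L)) : ¬ p ∣ Module.finrank k L := by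
  rwa [← IsGalois.card_aut_eq_finrank k L]

/-- `p ∤ #H'` for `H' ≤ Gal(L/k)` when `p ∤ #Gal(L/k)`. [folklore] -/
private theorem not_dvd_card_subgroup₃ {k : Type} [Field k] (L : IntermediateField k (AlgebraicClosure k))
    {p : ℕ} (hL : ¬ p ∣ Nat.card (L ≃ₐ[k] L)) (H' : Subgroup (L ≃ₐ[k] L)) [Fintype H'] :
    ¬ p ∣ Fintype.card H' := fun h => by
  apply hL
  refine h.trans ?_
  rw [← Nat.card_eq_fintype_card]
  exact Subgroup.card_subgroup_dvd_card H'

/-- `⟨c⟩ ⊔ H = {cᵐ h}` for `c` central. [folklore] -/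
private theorem exists_zpow_mul_of_mem_zpowers_sup₃ {G : Type*} [Group G] (c : G) (hc : ∀ g : G, g * c = c * g)
    (H : Subgroup G) {h' : G} (hh' : h' ∈ Subgroup.zpowers c ⊔ H) : ∃ m : ℤ, ∃ h ∈ H, h' = c ^ m * h := by
  haveI : (Subgroup.zpowers c).Normal := by
    refine ⟨fun a ha g => ?_⟩
    obtain ⟨m, rfl⟩ := Subgroup.mem_zpowers_iff.mp ha
    have hcomm : g * c ^ m = c ^ m * g := (((commute_iff_eq c g).mpr (hc g).symm).zpow_left m).eq.symm
    rw [hcomm, mul_inv_cancel_right]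
    exact ⟨m, rfl⟩
  have h1 : h' ∈ ((Subgroup.zpowers c ⊔ H : Subgroup G) : Set G) := hh'
  rw [Subgroup.normal_mul] at h1
  obtain ⟨i, hi, h, hh, rfl⟩ := Set.mem_mul.mp h1
  obtain ⟨m, rfl⟩ := Subgroup.mem_zpowers_iff.mp hi
  exact ⟨m, h, hh, rfl⟩

/-- The central form of the saturated inertia condition. [folklore] -/
private theorem saturated_of_central₃ {G : Type*} [Group G] (c : G) (hc : ∀ g : G, g * c = c * g) (H I : Subgroup G)
    (hcI : c ∈ I) (g h' : G) (hh' : h' ∈ Subgroup.zpowers c ⊔ H) : ∃ i ∈ I, ∃ h ∈ H, g * h' = i * g * h := by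
  obtain ⟨m, h, hh, rfl⟩ := exists_zpow_mul_of_mem_zpowers_sup₃ c hc H hh'
  refine ⟨c ^ m, I.zpow_mem hcI m, h, hh, ?_⟩
  have hcomm : g * c ^ m = c ^ m * g := (((commute_iff_eq c g).mpr (hc g).symm).zpow_left m).eq.symm
  rw [← mul_assoc, hcomm]

/-! ### §1 Every equivariant `Cl(𝓞_{L·K_n}) → E[p]` vanishes -/

set_option maxHeartbeats 1600000 in
set_option synthInstance.maxHeartbeats 400000 in
/-- **Rank equality kills the `E[p]`-isotypic component at every layer (image-agnostic form).**  `K` a number field, `p` odd, `κ` a `ℤ_p`-extension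
of `K` with a totally ramified prime, `E/K` elliptic, `L = K(E[p])` with `p ∤ #Gal(L/K)`; a basis `e` of `E[p]` and `σ_s, σ_m, σ_x ∈ Γ_K` acting as
`S` (first row `(1,0)`), `−1`, and `X` with `X₀₁ ≠ 0`.  If `#Cl(L^{⟨σ̄_s⟩})[p] = #Cl(L^{⟨σ̄_m, σ̄_s⟩})[p]` and `σ̄_m ∈ I(𝔮)` for every prime `𝔮 ∋ p` of
`L`, then for every `n` every additive `Γ_K`-equivariant `f : Cl(𝓞_{L·K_n}) → E[p]` is zero.  (Rank-equality transfer + Frobenius reciprocity on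
the character «first coordinate of `f`»; module docstring.) [cite: Iwasawa1956, §§3–5] [cite: SerreLinearRepresentations1977, §7.2 Thm. 13]
[cite: CoatesSujatha2005, §3 (proof of Thm. 3.4)] -/
theorem equivariantHom_geomTorsion_layer_eq_zero_of_rankEq
    {K : Type} [Field K] [NumberField K] {p : ℕ} [Fact p.Prime] (hp2 : p ≠ 2) (κ : ZpExtension K p)
    (hram : ∃ 𝔓' : Ideal (absIntegers (𝓞 K) K), 𝔓'.IsMaximal ∧
      𝔓'.inertia (absoluteGaloisGroup K) ⊔ κ.kerSubgroup = ⊤)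
    (W : WeierstrassCurve K) [W.IsElliptic]
    [∀ n, FiniteDimensional K (κ.layer n)] [∀ n, IsGalois K (κ.layer n)]
    [∀ n, NumberField ↥(W.divisionField p ⊔ κ.layer n)] [NumberField ↥(W.divisionField p)]
    (hG : ¬ p ∣ Nat.card (↥(W.divisionField p) ≃ₐ[K] ↥(W.divisionField p)))
    (e : W.geomTorsion p ≃+ (Fin 2 → ZMod p)) (σs σm σx : absoluteGaloisGroup K)
    {S : Matrix (Fin 2) (Fin 2) (ZMod p)} (hS0 : S 0 0 = 1) (hS1 : S 0 1 = 0)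
    (hσs : ∀ P : W.geomTorsion p, e (σs • P) = S *ᵥ e P)
    (hσm : ∀ P : W.geomTorsion p, e (σm • P) = -e P)
    {X : Matrix (Fin 2) (Fin 2) (ZMod p)} (hX : X 0 1 ≠ 0) (hσx : ∀ P : W.geomTorsion p, e (σx • P) = X *ᵥ e P)
    (hrank : Nat.card {d : ClassGroup (𝓞 ↥(fixedField (Subgroup.zpowers (absRestrictNormalHom (W.divisionField p) σs)))) // d ^ p = 1} =
      Nat.card {d : ClassGroup (𝓞 ↥(fixedField (Subgroup.zpowers (absRestrictNormalHom (W.divisionField p) σm) ⊔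
        Subgroup.zpowers (absRestrictNormalHom (W.divisionField p) σs)))) // d ^ p = 1})
    (hcI : ∀ (𝔮 : Ideal (𝓞 ↥(W.divisionField p))) [𝔮.IsMaximal], ((p : ℕ) : 𝓞 ↥(W.divisionField p)) ∈ 𝔮 →
      absRestrictNormalHom (W.divisionField p) σm ∈ 𝔮.inertia _)
    (n : ℕ) (f : Additive (ClassGroup (𝓞 ↥(W.divisionField p ⊔ κ.layer n))) →+ W.geomTorsion p)
    (hf : ∀ (τ : absoluteGaloisGroup K) (c : ClassGroup (𝓞 ↥(W.divisionField p ⊔ κ.layer n))),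
      f (Additive.ofMul (ClassGroup.mulEquiv (AmbiguousClass.intAut
        (absRestrictNormalHom (W.divisionField p ⊔ κ.layer n) τ)) c)) = τ • f (Additive.ofMul c)) :
    f = 0 := by
  classical
  haveI : NeZero p := ⟨(Fact.out : p.Prime).ne_zero⟩
  -- the faithful matrix representation of `Gal(K(E[p])/K)` in the basis `e`
  obtain ⟨ρm, hρm, hρme⟩ := exists_matrixRep_divisionField W p e
  have hmat : ∀ (σ : absoluteGaloisGroup K) (M : Matrix (Fin 2) (Fin 2) (ZMod p)),
      (∀ P, e (σ • P) = M *ᵥ e P) → ρm (absRestrictNormalHom _ σ) = M :=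
    fun σ M hM => matrix_eq_of_forall_mulVec₃ e fun P => by rw [← hρme, hM]
  have hπ := absRestrictNormalHom_surjective₃ (W.divisionField p)
  have hL₀ := not_dvd_finrank_of_not_dvd_card₃ (W.divisionField p) hG
  set mb := absRestrictNormalHom (W.divisionField p) σm with hmb
  set sb := absRestrictNormalHom (W.divisionField p) σs with hsb
  have hρs : ρm sb = S := hmat σs _ hσs
  have hρmneg : ρm mb = -1 := hmat σm _ fun P => by rw [hσm, Matrix.neg_mulVec, Matrix.one_mulVec]
  have hρx : ρm (absRestrictNormalHom (W.divisionField p) σx) = X := hmat σx _ hσx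
  have hc : ∀ g, g * mb = mb * g := fun g =>
    hρm (by rw [map_mul, map_mul, hρmneg, mul_neg_one, neg_one_mul])
  haveI : Fintype ↥(Subgroup.zpowers sb) := Fintype.ofFinite _
  haveI : Fintype ↥(Subgroup.zpowers mb ⊔ Subgroup.zpowers sb) := Fintype.ofFinite _
  have hpH' := not_dvd_card_subgroup₃ _ hG (Subgroup.zpowers mb ⊔ Subgroup.zpowers sb)
  -- (1) the rank-equality transfer: every equivariant map into the coset kernel vanishes at layer `n`
  have hvan : ∀ μ : Additive (ClassGroup (𝓞 ↥(W.divisionField p ⊔ κ.layer n))) →+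
      cosetKernel (Subgroup.zpowers sb) (Subgroup.zpowers mb ⊔ Subgroup.zpowers sb) (ZMod p),
      (∀ (τ : absoluteGaloisGroup K) (c : ClassGroup (𝓞 ↥(W.divisionField p ⊔ κ.layer n))),
        μ (Additive.ofMul (ClassGroup.mulEquiv (AmbiguousClass.intAut
          (absRestrictNormalHom (W.divisionField p ⊔ κ.layer n) τ)) c)) =
          absRestrictNormalHom (W.divisionField p) τ • μ (Additive.ofMul c)) → μ = 0 :=
    fun μ hμ => RankEqualityTransfer.equivariantHom_cosetKernel_layer_eq_zero_of_saturated hp2 κ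
      (W.divisionField p) hL₀ hram _ _ le_sup_right hpH' hrank
      (fun 𝔮 _ h𝔮 g h' hh' => saturated_of_central₃ _ hc _ _ (hcI 𝔮 h𝔮) g h' hh') n μ hμ
  -- (2) the Galois action on `Cl(𝓞_{L·K_n})` as a representation of `Γ_K`
  let ρE : (↥(W.divisionField p ⊔ κ.layer n) ≃ₐ[K] ↥(W.divisionField p ⊔ κ.layer n)) →*
      AddMonoid.End (Additive (ClassGroup (𝓞 ↥(W.divisionField p ⊔ κ.layer n)))) :=
    { toFun := fun σ => (ClassGroup.mulEquiv (AmbiguousClass.intAut σ)).toMonoidHom.toAdditive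
      map_one' := AddMonoidHom.ext fun a => by
        change Additive.ofMul (ClassGroup.mulEquiv (AmbiguousClass.intAut
          (1 : ↥(W.divisionField p ⊔ κ.layer n) ≃ₐ[K] ↥(W.divisionField p ⊔ κ.layer n))) (Additive.toMul a)) = a
        rw [AmbiguousClass.mulEquiv_intAut_one, MulEquiv.refl_apply, ofMul_toMul]
      map_mul' := fun σ τ => AddMonoidHom.ext fun a => by
        change Additive.ofMul (ClassGroup.mulEquiv (AmbiguousClass.intAut (σ * τ)) (Additive.toMul a)) =
          Additive.ofMul (ClassGroup.mulEquiv (AmbiguousClass.intAut σ)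
            (Additive.toMul (Additive.ofMul (ClassGroup.mulEquiv (AmbiguousClass.intAut τ) (Additive.toMul a)))))
        rw [AmbiguousClass.mulEquiv_intAut_mul, MulEquiv.trans_apply, toMul_ofMul] }
  let ρA : absoluteGaloisGroup K →* AddMonoid.End (Additive (ClassGroup (𝓞 ↥(W.divisionField p ⊔ κ.layer n)))) :=
    ρE.comp (absRestrictNormalHom (W.divisionField p ⊔ κ.layer n))
  have hfρ : ∀ (τ : absoluteGaloisGroup K) (a : Additive (ClassGroup (𝓞 ↥(W.divisionField p ⊔ κ.layer n)))),
      f (ρA τ a) = τ • f a := fun τ a => hf τ (Additive.toMul a)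
  -- (3) the character «first coordinate of `f`»
  let lam : W.geomTorsion p →+ ZMod p := (Pi.evalAddMonoidHom (fun _ : Fin 2 => ZMod p) 0).comp e.toAddMonoidHom
  let ν : Additive (ClassGroup (𝓞 ↥(W.divisionField p ⊔ κ.layer n))) →+ ZMod p := lam.comp f
  have hν : ∀ a, ν a = (e (f a)) 0 := fun _ => rfl
  -- `ν` is `H`-invariant (the first row of `S` is `(1,0)`)
  have hνH : ∀ τ : absoluteGaloisGroup K, absRestrictNormalHom (W.divisionField p) τ ∈ Subgroup.zpowers sb →
      ∀ a, ν (ρA τ a) = ν a := by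
    intro τ hτ a
    rw [hν, hν, hfρ, hρme]
    rw [← (isOfFinOrder_of_finite sb).mem_powers_iff_mem_zpowers] at hτ
    obtain ⟨k, hk⟩ := (Submonoid.mem_powers_iff _ _).mp hτ
    rw [← hk, map_pow, hρs]
    exact pow_mulVec_zero_of_row S hS0 hS1 k _
  -- `#H'` is invertible in `𝔽_p`
  obtain ⟨u, hu⟩ : ∃ u : ℤ, ∀ r : ZMod p,
      u • (Fintype.card ↥(Subgroup.zpowers mb ⊔ Subgroup.zpowers sb) • r) = r := by
    have h0 : ((Fintype.card ↥(Subgroup.zpowers mb ⊔ Subgroup.zpowers sb) : ℕ) : ZMod p) ≠ 0 :=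
      fun h => hpH' ((ZMod.natCast_eq_zero_iff _ _).mp h)
    refine ⟨((((Fintype.card ↥(Subgroup.zpowers mb ⊔ Subgroup.zpowers sb) : ℕ) : ZMod p)⁻¹).val : ℕ), fun r => ?_⟩
    rw [nsmul_eq_mul, zsmul_eq_mul, Int.cast_natCast, ZMod.natCast_zmod_val, ← mul_assoc, inv_mul_cancel₀ h0, one_mul]
  -- a section of `Γ_K → Gal(L/K)`
  have hsec : ∀ g, absRestrictNormalHom (W.divisionField p) (Function.surjInv hπ g) = g := Function.surjInv_eq hπ
  -- (4) Frobenius reciprocity: `ν` is `H'`-invariant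
  have hνH' := invariant_lift_of_forall_equivariantHom_eq_zero (Subgroup.zpowers sb)
    (Subgroup.zpowers mb ⊔ Subgroup.zpowers sb) (ZMod p) (absRestrictNormalHom (W.divisionField p)) ρA
    le_sup_right (Function.surjInv hπ) hsec u hu (fun μ hμ => hvan μ fun τ c => hμ τ (Additive.ofMul c)) ν hνH
  -- (5) at `σ_m` (acting as `−1`): `ν = 0`
  have hmmem : absRestrictNormalHom (W.divisionField p) σm ∈ Subgroup.zpowers mb ⊔ Subgroup.zpowers sb :=
    Subgroup.mem_sup_left (Subgroup.mem_zpowers _)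
  have hν0 : ∀ a, (e (f a)) 0 = 0 := fun a => by
    have h1 := hνH' σm hmmem a
    rw [hν, hν, hfρ, hσm, Pi.neg_apply] at h1
    exact zmod_eq_zero_of_neg_eq hp2 _ h1
  -- (6) at `σ_x`: the second coordinate vanishes too
  have hcoord : ∀ a, e (f a) = 0 := fun a => by
    have h0 := hν0 a
    have h1 := hν0 (ρA σx a)
    rw [hfρ, hσx, mulVec_zero_eq, h0, mul_zero, zero_add] at h1
    have h2 : (e (f a)) 1 = 0 := (mul_eq_zero.mp h1).resolve_left hX
    funext i
    fin_cases i
    · exact h0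
    · exact h2
  exact AddMonoidHom.ext fun a => e.injective ((hcoord a).trans (map_zero e).symm)

/-! ### §2 Statement (A) at `(E, p)` from the rank equality (over `ℚ`) -/

set_option maxHeartbeats 1600000 in
set_option synthInstance.maxHeartbeats 400000 in
/-- **(A) at `(E, p)` FROM THE RANK EQUALITY — image-agnostic, no named fact, no `μ`-hypothesis.**  `E/ℚ` elliptic, `p` odd, `p ∤ #Gal(ℚ(E[p])/ℚ)`;
a basis `e` of `E[p]` and `σ_s, σ_m, σ_x ∈ Γ_ℚ` acting as `S` (first row `(1,0)`), `−1`, `X` (`X₀₁ ≠ 0`); if `#Cl(ℚ(E[p])^{⟨σ̄_s⟩})[p] = #Cl(ℚ(E[p])^{⟨σ̄_m, σ̄_s⟩})[p]`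
and `σ̄_m ∈ I(𝔮)` for every prime `𝔮 ∋ p` of `ℚ(E[p])`, then the dual fine Selmer group of `E` over `ℚ_cyc` is finitely generated over `ℤ_p`, for every
cyclotomic `ℤ_p`-extension (door L5 `conjA_of_homTrivial_layer_above_p` at layer 1 fed by §1).  Instances: `C_ns⁺(5)` rows (`σ_s = diag(1,4)`,
`σ_m = σ_x¹²`, `X = R_ε`: `FineSelmerRankEqualityNonsplitCartanFive`), `C_s⁺(5)`, `G₁₆`, `5S4` rows, and `p = 3` images of order prime to `3`.
[cite: CoatesSujatha2005, §3 Thm. 3.4 and Lemma 3.8] [cite: DeoRaySujatha2023, §3 Thm. 3.8 (arXiv:2202.09937 p. 9)] [cite: Iwasawa1956, §§3–5] -/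
theorem conjA_of_rankEq (W : WeierstrassCurve ℚ) [W.IsElliptic] {p : ℕ} [Fact p.Prime] (hp2 : p ≠ 2)
    (hG : ¬ p ∣ Nat.card (↥(W.divisionField p) ≃ₐ[ℚ] ↥(W.divisionField p)))
    (e : W.geomTorsion p ≃+ (Fin 2 → ZMod p)) (σs σm σx : absoluteGaloisGroup ℚ)
    {S : Matrix (Fin 2) (Fin 2) (ZMod p)} (hS0 : S 0 0 = 1) (hS1 : S 0 1 = 0)
    (hσs : ∀ P : W.geomTorsion p, e (σs • P) = S *ᵥ e P)
    (hσm : ∀ P : W.geomTorsion p, e (σm • P) = -e P)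
    {X : Matrix (Fin 2) (Fin 2) (ZMod p)} (hX : X 0 1 ≠ 0) (hσx : ∀ P : W.geomTorsion p, e (σx • P) = X *ᵥ e P)
    (hrank : Nat.card {d : ClassGroup (𝓞 ↥(fixedField (Subgroup.zpowers (absRestrictNormalHom (W.divisionField p) σs)))) // d ^ p = 1} =
      Nat.card {d : ClassGroup (𝓞 ↥(fixedField (Subgroup.zpowers (absRestrictNormalHom (W.divisionField p) σm) ⊔
        Subgroup.zpowers (absRestrictNormalHom (W.divisionField p) σs)))) // d ^ p = 1})
    (hcI : ∀ (𝔮 : Ideal (𝓞 ↥(W.divisionField p))) [𝔮.IsMaximal], ((p : ℕ) : 𝓞 ↥(W.divisionField p)) ∈ 𝔮 →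
      absRestrictNormalHom (W.divisionField p) σm ∈ 𝔮.inertia _)
    (κ : ZpExtension ℚ p) (hκ : κ.IsCyclotomic) :
    ∃ (γ : absoluteGaloisGroup ℚ) (D : W.FineSelmerDualData κ γ),
      Module.Finite ℤ_[p] (RestrictScalars ℤ_[p] (IwasawaAlgebra p) D.X) := by
  classical
  haveI : NeZero p := ⟨(Fact.out : p.Prime).ne_zero⟩
  haveI := fun m => κ.isGalois_layer_holds m
  haveI := fun m => κ.finiteDimensional_layer_holds m
  haveI hNF : ∀ m, NumberField ↥(W.divisionField p ⊔ κ.layer m) := fun m => NumberField.of_module_finite ℚ _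
  haveI : NumberField ↥(W.divisionField p) := NumberField.mk
  have hram := EquivariantIwasawaLemma.exists_isMaximal_inertia_sup_kerSubgroup_eq_top_of_isCyclotomic hκ
  exact conjA_of_homTrivial_layer_above_p W hp2 hG hκ 0 (fun f hf _ =>
    equivariantHom_geomTorsion_layer_eq_zero_of_rankEq hp2 κ hram W hG e σs σm σx hS0 hS1 hσs hσm hX hσx hrank hcI
      (0 + 1) f hf)

end RankEqualityRoad

end Literature.NumberTheory.EllipticCurves.CoatesSujatha2005

end
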